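import Mathlib
import Literature.Barriers.ValiantsHypothesis.AlgebraicNaturalProofs
import Literature.Computability.AlgebraicComplexity.ArithCircuitProofs
import Literature.Computability.AlgebraicComplexity.RazUniversalCircuits
import Summits.ValiantsHypothesis.ValiantsHypothesis.Theorems.DivisionGapZeroOneTransferStubSqrtCheap
import Summits.ValiantsHypothesis.ValiantsHypothesis.Theorems.BarrierLeverSuccinctHittingSetsForVPLowDegree
import Summits.ValiantsHypothesis.ValiantsHypothesis.Theorems.BarrierLeverSuccinctHittingSetsForVPDimensionCount
import HarnessLib

/-!
# Crux `BarrierLever.SuccinctHittingSetsForVP` (stmt-ValiantsHypothesis-14610), line `registered` —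
SMALL CIRCUITS ARE POLYNOMIALLY PARAMETRISED (FSV's universal-circuit reformulation, refuter side)

**What is proved (unconditional; structure of the open stub `stub_levelOne`, it does NOT close the
item).** For every size exponent `b` and every `n ≥ 1` there is an explicit polynomial map
`G : ℂ^p → ℂ^N` (`N = C(2n,n)` coefficient coordinates indexed by `degLEMonomials n`) with

* `p ≤ 9376 (n+4)^(5b+21)` parameters (polynomially many),
* coordinates of total degree `≤ 2n`,
* whose image CONTAINS the coefficient vector of every `f ∈ SmallCircuits ℂ n b`
  (`exists_parametrization`, registered stub `stub_polyParametrization`).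

Consequently (`vanishes_of_aeval_parametrization_eq_zero`) every polynomial `D` in the coefficient
variables with `D ∘ G ≡ 0` is an equation of `SmallCircuits ℂ n b` — the refuter's form of level
one: a NONZERO `D` of size and degree `≤ N` with `D ∘ G = 0` in `ℂ[y₁,…,y_p]` disproves
`stub_levelOne` (FSV 2018, §1.3/§3: succinct hitting sets vs. generators from universal circuits;
the converse needs the size of the universal circuit and is not proved here).

**Construction.** `s' = (n+1)(n^b+n+2) + n + 1` bounds the complexity of `f_k · x₀^(n-k)` for every
homogeneous component `f_k` (`k ≥ 1`) of a member `f` of `SmallCircuits ℂ n b` (interpolation,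
`SqrtCheap.complexity_homogeneousComponent_le`); these are homogeneous of degree `n`, so by Raz's
universal circuit-graph with `W = 4 s' (n+1)²` slots (`RazUniversal.exists_eval_uCoeff_eq_coeff`,
Raz 2010 Prop. 3.3) their coefficient vectors are values `Γ(y_k)` of ONE polynomial map with label
set `Lab (Fin n) n W`. Parameters: one coordinate `c₀` for the constant term plus `n + 1` copies of
the labels; `G_m = c₀` if `m = 0`, and `G_m = Γ_{m + (n - |m|) e₀}(y_{|m|})` otherwise
(`coeff_mul_X_pow_shift`: the coefficient of `x^m` in `f_k` is that of `x^(m + (n-k)e₀)` in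
`f_k x₀^(n-k)`). Axioms: `propext`, `Classical.choice`, `Quot.sound`.

References: [ForbesShpilkaVolk2018] §1.3 and §3 (universal circuits and succinct generators),
Question 6; [Raz2010] Prop. 3.2–3.3.
-/

-- layout Summits/ValiantsHypothesis/ValiantsHypothesis forces the duplicated namespace component
set_option linter.dupNamespace false

namespace Summit.ValiantsHypothesis.ValiantsHypothesis.Theorems.BarrierLever.SuccinctHittingSetsForVP

open Literature.Barriers.ValiantsHypothesis Literature.Computability.AlgebraicComplexity MvPolynomial

namespace PolyParametrization

/-- Shifting by a power of one variable: `coeff_{m + j e_i} (g · x_i^j) = coeff_m g`. [folklore] -/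
theorem coeff_mul_X_pow_shift {n : ℕ} (g : MvPolynomial (Fin n) ℂ) (i : Fin n) (j : ℕ)
    (m : Fin n →₀ ℕ) : coeff (m + Finsupp.single i j) (g * X i ^ j) = coeff m g := by
  rw [X_pow_eq_monomial, coeff_mul_monomial', if_pos le_add_self, add_tsub_cancel_right, mul_one]

/-- `f_k · x_i^(n-k)` is homogeneous of degree `n` for the degree-`k` component `f_k`, `k ≤ n`.
[folklore] -/
theorem isHomogeneous_component_mul {n : ℕ} (f : MvPolynomial (Fin n) ℂ) (i : Fin n) {k : ℕ}
    (hk : k ≤ n) : (homogeneousComponent k f * X i ^ (n - k)).IsHomogeneous n := by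
  have h := (homogeneousComponent_isHomogeneous k f).mul ((isHomogeneous_X ℂ i).pow (n - k))
  rwa [one_mul, Nat.add_sub_cancel' hk] at h

/-- Its complexity: `L(f_k x_i^(n-k)) ≤ (n+1)(L(f)+n+2) + n + 1` for `deg f ≤ n`.
[cite: Burgisser2000, §2.1] -/
theorem complexity_component_mul_le {n : ℕ} (f : MvPolynomial (Fin n) ℂ) (hf : f.totalDegree ≤ n)
    (i : Fin n) (k : ℕ) :
    complexity (homogeneousComponent k f * X i ^ (n - k)) ≤
      (n + 1) * (complexity f + n + 2) + n + 1 := by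
  have h1 := Summit.ValiantsHypothesis.ValiantsHypothesis.Theorems.DivisionGapZeroOneTransfer.SqrtCheap.complexity_homogeneousComponent_le
    f hf k
  rw [Fintype.card_fin] at h1
  have h2 := LowDegree.complexity_X_pow_le (n := n) i (n - k)
  calc complexity (homogeneousComponent k f * X i ^ (n - k))
      ≤ complexity (homogeneousComponent k f) + complexity (X i ^ (n - k)) + 1 :=
        complexity_mul_le_holds _ _
    _ ≤ (n + 1) * (complexity f + n + 2) + (n - k) + 1 := by omega
    _ ≤ (n + 1) * (complexity f + n + 2) + n + 1 := by omega

/-- `n ^ b + n + 3 ≤ (n + 4) ^ (b + 1)`. [folklore] -/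
theorem base_le' (n b : ℕ) : n ^ b + n + 3 ≤ (n + 4) ^ (b + 1) := by
  have h1 : n ^ b ≤ (n + 4) ^ b := Nat.pow_le_pow_left (by omega) b
  have h2 : 1 ≤ (n + 4) ^ b := Nat.one_le_pow _ _ (by omega)
  calc n ^ b + n + 3 ≤ (n + 4) ^ b + (n + 4) ^ b * (n + 3) := by nlinarith
    _ = (n + 4) ^ (b + 1) := by ring

/-- The parameter count is polynomial: with `s' = (n+1)(n^b+n+2) + n + 1` and `W = 4 s' (n+1)²`,
`1 + (n+1) · #Lab(Fin n, n, W) ≤ 9376 (n+4)^(5b+21)`. [cite: Raz2010, Prop. 3.3 (p. 158)] -/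
theorem card_params_le (n b : ℕ) :
    1 + (n + 1) * Fintype.card (RazUniversal.Lab (Fin n) n
      (4 * ((n + 1) * (n ^ b + n + 2) + n + 1) * (n + 1) ^ 2)) ≤ 9376 * (n + 4) ^ (5 * b + 21) := by
  set s' := (n + 1) * (n ^ b + n + 2) + n + 1 with hs'
  have hB := base_le' n b
  have hs'le : s' ≤ (n + 4) ^ (b + 2) := by
    calc s' = (n + 1) * (n ^ b + n + 3) := by rw [hs']; ring
      _ ≤ (n + 4) * (n + 4) ^ (b + 1) := Nat.mul_le_mul (by omega) hB
      _ = (n + 4) ^ (b + 2) := by ring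
  have hW : n + n + 4 * s' * (n + 1) ^ 2 + 1 ≤ 5 * (n + 4) ^ (b + 4) := by
    have h3 : (n + 1) ^ 2 ≤ (n + 4) ^ 2 := Nat.pow_le_pow_left (by omega) 2
    have h4 : 4 * s' * (n + 1) ^ 2 ≤ 4 * (n + 4) ^ (b + 4) := by
      calc 4 * s' * (n + 1) ^ 2 ≤ 4 * (n + 4) ^ (b + 2) * (n + 4) ^ 2 := by gcongr
        _ = 4 * (n + 4) ^ (b + 4) := by ring
    have h5 : n + n + 1 ≤ (n + 4) ^ (b + 4) := by
      calc n + n + 1 ≤ (n + 4) ^ 1 * (n + 4) ^ 1 := by nlinarith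
        _ = (n + 4) ^ 2 := by ring
        _ ≤ (n + 4) ^ (b + 4) := Nat.pow_le_pow_right (by omega) (by omega)
    omega
  have hlab : Fintype.card (RazUniversal.Lab (Fin n) n (4 * s' * (n + 1) ^ 2)) ≤
      9375 * (n + 4) ^ (5 * b + 20) := by
    refine (RazUniversal.card_lab_le (Fin n) n _).trans ?_
    rw [Fintype.card_fin]
    calc 3 * (n + n + 4 * s' * (n + 1) ^ 2 + 1) ^ 5 ≤ 3 * (5 * (n + 4) ^ (b + 4)) ^ 5 := by
          gcongr
      _ = 9375 * (n + 4) ^ (5 * b + 20) := by rw [mul_pow, ← pow_mul]; ring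
  have h1 : 1 ≤ (n + 4) ^ (5 * b + 21) := Nat.one_le_pow _ _ (by omega)
  calc 1 + (n + 1) * Fintype.card (RazUniversal.Lab (Fin n) n (4 * s' * (n + 1) ^ 2))
      ≤ 1 + (n + 4) * (9375 * (n + 4) ^ (5 * b + 20)) := by gcongr; omega
    _ = 1 + 9375 * (n + 4) ^ (5 * b + 21) := by ring
    _ ≤ 9376 * (n + 4) ^ (5 * b + 21) := by omega

end PolyParametrization

open PolyParametrization

/-- **Polynomial parametrisation of small circuits (FSV's universal-circuit reformulation).** For
every `b` and `n ≥ 1` there are `p ≤ 9376 (n+4)^(5b+21)` and a polynomial map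
`G : degLEMonomials n → ℂ[y₁,…,y_p]` with coordinates of total degree `≤ 2n` such that the
coefficient vector of every `f ∈ SmallCircuits ℂ n b` is a value of `G`: `coeff_m f = G_m(y)` for
some `y ∈ ℂ^p` and all `m`. [cite: ForbesShpilkaVolk2018, §3; Raz2010, Prop. 3.3 (p. 158)] -/
theorem exists_parametrization (b n : ℕ) (hn : 1 ≤ n) :
    ∃ (p : ℕ) (G : degLEMonomials n → MvPolynomial (Fin p) ℂ),
      p ≤ 9376 * (n + 4) ^ (5 * b + 21) ∧ (∀ m, (G m).totalDegree ≤ 2 * n) ∧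
      ∀ f ∈ SmallCircuits ℂ n b, ∃ y : Fin p → ℂ, ∀ m,
        eval y (G m) = coeff (m : Fin n →₀ ℕ) f := by
  classical
  -- parameters
  set s' := (n + 1) * (n ^ b + n + 2) + n + 1 with hs'
  set W := 4 * s' * (n + 1) ^ 2 with hW
  let L := RazUniversal.Lab (Fin n) n W
  let P := Unit ⊕ (Fin (n + 1) × L)
  let i₀ : Fin n := ⟨0, hn⟩
  -- the shifted exponent of a monomial of degree `k`: `m + (n - k) e₀`, of degree `n`
  let sh : degLEMonomials n → (Fin n →₀ ℕ) := fun m =>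
    (m : Fin n →₀ ℕ) + Finsupp.single i₀ (n - (m : Fin n →₀ ℕ).degree)
  let lvl : degLEMonomials n → Fin (n + 1) := fun m =>
    ⟨(m : Fin n →₀ ℕ).degree, Nat.lt_succ_of_le m.2⟩
  -- the map, on the abstract parameter type `P`
  let G₀ : degLEMonomials n → MvPolynomial P ℂ := fun m =>
    if (m : Fin n →₀ ℕ).degree = 0 then X (Sum.inl ())
    else rename (fun l : L => (Sum.inr (lvl m, l) : P)) (RazUniversal.uCoeff ℂ (Fin n) n W (sh m))
  -- transport to `Fin p`
  let e := Fintype.equivFin P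
  refine ⟨Fintype.card P, fun m => rename e (G₀ m), ?_, ?_, ?_⟩
  · -- parameter count
    have : Fintype.card P = 1 + (n + 1) * Fintype.card L := by
      simp [P, L, Fintype.card_sum, Fintype.card_prod, Fintype.card_fin]
    rw [this]
    exact card_params_le n b
  · -- degrees
    intro m
    refine (totalDegree_rename_le _ _).trans ?_
    simp only [G₀]
    split_ifs
    · rw [totalDegree_X]; omega
    · exact (totalDegree_rename_le _ _).trans
        ((RazUniversal.totalDegree_uCoeff_le _).trans (by omega))
  · -- universality
    intro f hf
    -- a labelling for each positive degree `k`
    have hlab : ∀ k : Fin (n + 1), ∃ y : L → ℂ, 1 ≤ (k : ℕ) →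
        ∀ e, eval y (RazUniversal.uCoeff ℂ (Fin n) n W e) =
          coeff e (homogeneousComponent k f * X i₀ ^ (n - k)) := by
      intro k
      by_cases hk : 1 ≤ (k : ℕ)
      · have hkn : (k : ℕ) ≤ n := Nat.lt_succ_iff.mp k.isLt
        have hg := isHomogeneous_component_mul f i₀ hkn
        have hgc : complexity (homogeneousComponent (k : ℕ) f * X i₀ ^ (n - k)) ≤ s' := by
          refine (complexity_component_mul_le f hf.1 i₀ k).trans ?_
          rw [hs']
          have := hf.2
          gcongr
        obtain ⟨y, hy⟩ := RazUniversal.exists_eval_uCoeff_eq_coeff (R := ℂ) (σ := Fin n)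
          (r := n) (N := W) (s := s') hn le_rfl hg hgc
        exact ⟨y, fun _ => hy⟩
      · exact ⟨fun _ => 0, fun h => absurd h hk⟩
    choose y hy using hlab
    let Y : P → ℂ := Sum.elim (fun _ => coeff 0 f) (fun kl => y kl.1 kl.2)
    refine ⟨Y ∘ e.symm, fun m => ?_⟩
    rw [eval_rename, Function.comp_assoc, Equiv.symm_comp_self, Function.comp_id]
    simp only [G₀]
    split_ifs with h0
    · rw [eval_X]
      have hm0 : (m : Fin n →₀ ℕ) = 0 := (Finsupp.degree_eq_zero_iff _).mp h0
      simp [Y, hm0]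
    · rw [eval_rename]
      have hk1 : 1 ≤ ((lvl m : Fin (n + 1)) : ℕ) := Nat.one_le_iff_ne_zero.mpr h0
      have hcomp : Y ∘ (fun l : L => (Sum.inr (lvl m, l) : P)) = y (lvl m) := by
        funext l; simp [Y]
      rw [hcomp, hy (lvl m) hk1 (sh m)]
      simp only [sh, lvl]
      rw [coeff_mul_X_pow_shift, coeff_homogeneousComponent, if_pos rfl]

/-- **The refuter's form of level one (all degrees).** With `G` as in `exists_parametrization`:
every `D` with `D ∘ G = 0` vanishes at the coefficient vector of every `f ∈ SmallCircuits ℂ n b`;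
so a NONZERO such `D` with `L(D) ≤ N` and `deg D ≤ N` (for the `b` attached to level one) refutes
`stub_levelOne`. [cite: ForbesShpilkaVolk2018, Thm. 4 and §3] -/
theorem vanishes_of_aeval_parametrization_eq_zero {n b p : ℕ}
    {G : degLEMonomials n → MvPolynomial (Fin p) ℂ}
    (hG : ∀ f ∈ SmallCircuits ℂ n b, ∃ y : Fin p → ℂ, ∀ m,
      eval y (G m) = coeff (m : Fin n →₀ ℕ) f)
    {D : MvPolynomial (degLEMonomials n) ℂ} (hD : aeval G D = 0) :
    ∀ f ∈ SmallCircuits ℂ n b, eval (coeffVector (degLEMonomials n) f) D = 0 := by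
  intro f hf
  obtain ⟨y, hy⟩ := hG f hf
  have hpt : coeffVector (degLEMonomials n) f = fun m => eval y (G m) := by
    funext m; rw [coeffVector_apply, hy]
  rw [hpt, ← LowDegreeEquations.eval_comp_aeval, hD, map_zero]

/-- **Registered stub `stub_polyParametrization`** (crux stmt-ValiantsHypothesis-14610, line
`registered`; STRUCTURE of the open stub `stub_levelOne`): the coefficient vectors of
`SmallCircuits ℂ n b` lie in the image of a polynomial map with `≤ 9376 (n+4)^(5b+21)` parameters
and coordinates of degree `≤ 2n`. [cite: ForbesShpilkaVolk2018, §3; Raz2010, Prop. 3.3] -/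
theorem stub_polyParametrization :
    ∀ b n : ℕ, 1 ≤ n →
      ∃ (p : ℕ) (G : degLEMonomials n → MvPolynomial (Fin p) ℂ),
        p ≤ 9376 * (n + 4) ^ (5 * b + 21) ∧ (∀ m, (G m).totalDegree ≤ 2 * n) ∧
        ∀ f ∈ SmallCircuits ℂ n b, ∃ y : Fin p → ℂ, ∀ m,
          MvPolynomial.eval y (G m) = MvPolynomial.coeff (m : Fin n →₀ ℕ) f :=
  exists_parametrization

end Summit.ValiantsHypothesis.ValiantsHypothesis.Theorems.BarrierLever.SuccinctHittingSetsForVP
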